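import Summits.QuantumFields.BalabanUV.T4Continuum.Spine.NE1p.DressedSmallFieldNestedToriTowerEnd
import Summits.QuantumFields.BalabanUV.T4Continuum.Spine.NE1p.DressedSmallFieldRodRateWitnessLive

/-!
# T⁴ programme, spine estimate NE1′ (node O3b/H2) — THE TOWER, PART 3 of 3: THE END's BOUNDED QUANTITY IS NOT ZERO OFF THE BOUNDARY —
# `exp E_w(C_R) = 1 + w(C_R)` by leaf-09's SINGLE-SUPPORT LEMMA, `E₁(C_R) ≠ E₀(C_R)`, the closing example at `L = 5` and `L = 13`

Cell `pub-balaban`, sub-cell `t4`, BINDER-OWNERS row NE1′; crew `b2b-balaban-t4-ne1p-formalise-*`, row **W75 ∕ DAG N29zzzzd** of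
`t4/formal/NE1p/LEAVES.md` (INTENT `HOME/CLAIMS.log` l.22679, RESERVED typer R-T139 l.22796, STAGED l.22850), unit
`b2b-balaban-t4-ne1p-formalise-leaf-10` (gen 12).  PART 3 of 3 — imports PART 2
`Spine/NE1p/DressedSmallFieldNestedToriTowerEnd` and leaf-09-g13's `Spine/NE1p/DressedSmallFieldRodRateWitnessLive` (for its GENERAL lemma
`exp_locE_of_support_single` over `B13Resummation.locE`; DISCLOSURE: consumer relation only, that row consumes W67's `CR` the other way) ONLY,
and re-enters PART 1's namespace; THEOREMS ONLY (0 def, 0 `def … : Prop`, 0 cite, 0 sorry, 0 `attribute`) + one closing `example`; nothing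
of PART 1∕2 ∕ leaf-09 ∕ W24 ∕ pv22 restated.

* §8 **`exp_locE_actT`**: `exp E_{act k s}(C_R) = 1 + act k s (C_R)` for `‖s‖ ≤ 2` — the activity lives, among the polymers inside `C_R`, on
  the ONE polymer `C_R` of footprint `C_R` (PART 2 `actT_of_ne`) and `‖act k s (C_R)‖ < 1` (PART 2), so leaf-09's `exp_locE_of_support_single`
  applies at `ι := TTouch`, `cubes := (·).1`, `p := CR L M`, `hp := rfl`; **`towerEnd_live`**: `E₁(C_R) ≠ E₀(C_R)` (else equal activities,
  against PART 2's `actT_live`); the closing `example`: liveness ∧ PART 2's closed bound `K₀(64,8)·e^{−3}` ∧ `decayFactor_lt_one` at `L = 5`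
  (the least blocking factor admitted by the rod's closure) and at `L = 13` ([Balaban1987RGI] p. 251 «L an odd positive integer > 11» —
  TYPE only), on every base torus `M`, every `0 < r`, every scale index `k`.

HONEST FRAMING as PARTS 1–2: a DECIDED TOY; W24's `exp_locE_cube` argument carried to a THREE-cube footprint by leaf-09's lemma about the
tree's OWN Kotecký–Preiss objects (no Bałaban object in it); nothing asserted about Bałaban's densities; 0 binders instantiated on Bałaban's
densities; no wall item; wall v1.8 (T4-DAG v48) — words, not kind — does NOT move; R-t4r2-Q2 NOT met; NE1′ ⇐ the named binders — NOT
proved, NOT printed; spine PROVED 0∕9; count 9 unchanged; ABSOLUTE RULE honoured.  Rung (B)+1 on ONE finite four-torus — NOT infinite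
volume, NOT a mass gap, NOT OS on ℝ⁴, NOT Clay.  HONEST DEPENDENCY: continuum YM on T⁴ ⇐ BetaPertH ∧ nine spine estimates (0/9 proved);
BetaPertH ⇐ (D1) ∧ (D4) ∧ CAP+tail; G-an2-4 gates asym, D1 and NE2/3/4.
-/

noncomputable section

namespace Summit.QuantumFields.BalabanUV.T4Continuum.NE1p.DressedSmallFieldNestedToriTower

open Complex
open Literature.MathematicalPhysics.QuantumFieldTheory.Balaban1983to89
open Literature.MathematicalPhysics.QuantumFieldTheory.Balaban1983to89.B12TreeDecay (K₀)
open Literature.MathematicalPhysics.QuantumFieldTheory.Balaban1983to89.B13Resummation (locE)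
open Literature.MathematicalPhysics.QuantumFieldTheory.Balaban1983to89.TreeLengthTorus (TDom tsys torusTreeLen)
open Literature.MathematicalPhysics.QuantumFieldTheory.Balaban1983to89.TreeLengthTorusGeometry (TTouch ttouch_symm)
open Summit.QuantumFields.BalabanUV.T4Continuum.NE1p.DressedSmallFieldNestedToriRod (CR)
open Summit.QuantumFields.BalabanUV.T4Continuum.NE1p.DressedSmallFieldRodRateWitness (exp_locE_of_support_single)

section Live
variable (L M : ℕ) [NeZero L] [NeZero M] (r : ℝ) (hr : 0 ≤ r)

/-! ## §8 `exp E_w(C_R) = 1 + w(C_R)` BY leaf-09's SINGLE-SUPPORT LEMMA; THE END's QUANTITY IS NOT ZERO; the closing example -/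

open Classical in
/-- **`exp E_{act k s}(C_R) = 1 + act k s C_R`** for `‖s‖ ≤ 2`: leaf-09-g13's `exp_locE_of_support_single` BY NAME (the activity lives, among
the polymers inside `C_R`, on `C_R` alone — `actT_of_ne` — and `‖act k s C_R‖ < 1`). [folklore] -/
theorem exp_locE_actT (hL : 5 ≤ L) (k : ℕ) {s : ℂ} (hs : ‖s‖ ≤ 2) :
    cexp (locE (TTouch (d := 4) (N := L * M)) (fun Z : (tsys 4 (L * M)).Dom => Z.1) (actT L M r hr k s) (CR L M).1) =
      1 + actT L M r hr k s (CR L M) :=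
  exp_locE_of_support_single (TTouch (d := 4) (N := L * M)) (fun _ _ h => ttouch_symm _ _ h)
    (fun Z : (tsys 4 (L * M)).Dom => Z.1) (actT L M r hr k s) rfl (fun _ _ hZ => actT_of_ne L M r hr hZ k s)
    (norm_actT_CR_lt_one L M r hr hL k hs)

open Classical in
/-- **THE END's BOUNDED QUANTITY IS NOT ZERO ON THE TOWER** [decided toy]: equal dressed outputs at the rod would give equal activities
(`exp_locE_actT` twice), contradicting `actT_live`. [folklore] -/
theorem towerEnd_live (hL : 5 ≤ L) (hr0 : 0 < r) (k : ℕ) :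
    locE (TTouch (d := 4) (N := L * M)) (fun Z : (tsys 4 (L * M)).Dom => Z.1) (actT L M r hr k 1) (CR L M).1 ≠
      locE (TTouch (d := 4) (N := L * M)) (fun Z : (tsys 4 (L * M)).Dom => Z.1) (actT L M r hr k 0) (CR L M).1 := by
  intro h
  have h' := congrArg cexp h
  rw [exp_locE_actT L M r hr hL k (by simp), exp_locE_actT L M r hr hL k (by simp), add_right_inj] at h'
  exact actT_live L M r hr hL hr0 k h'

open Classical in
/-- **S44's NESTED-TORI END FIRES OFF THE BOUNDARY ON BOTH COUNTS, ON A LIVE DATUM**, at the least blocking factor admitted here `L = 5` and at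
print's least admitted one `L = 13` ([Balaban1987RGI] p.251 «L an odd positive integer > 11» — TYPE only), on every base torus `M`: liveness ∧
the closed bound `K₀(64,8)·e^{−3}` ∧ the decay factor `e^{−½·d(C_R)} < 1`. [folklore] -/
example (hr0 : 0 < r) (k : ℕ) :
    (locE (TTouch (d := 4) (N := 5 * M)) (fun Z : (tsys 4 (5 * M)).Dom => Z.1) (actT 5 M r hr k 1) (CR 5 M).1 ≠
        locE (TTouch (d := 4) (N := 5 * M)) (fun Z : (tsys 4 (5 * M)).Dom => Z.1) (actT 5 M r hr k 0) (CR 5 M).1 ∧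
      ‖locE (TTouch (d := 4) (N := 5 * M)) (fun Z : (tsys 4 (5 * M)).Dom => Z.1) (actT 5 M r hr k 1) (CR 5 M).1 -
          locE (TTouch (d := 4) (N := 5 * M)) (fun Z : (tsys 4 (5 * M)).Dom => Z.1) (actT 5 M r hr k 0) (CR 5 M).1‖ ≤
        K₀ 64 8 * Real.exp (-3) ∧
      Real.exp (-(1 / 2 * torusTreeLen (CR 5 M).1)) < 1) ∧
    (locE (TTouch (d := 4) (N := 13 * M)) (fun Z : (tsys 4 (13 * M)).Dom => Z.1) (actT 13 M r hr k 1) (CR 13 M).1 ≠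
        locE (TTouch (d := 4) (N := 13 * M)) (fun Z : (tsys 4 (13 * M)).Dom => Z.1) (actT 13 M r hr k 0) (CR 13 M).1 ∧
      ‖locE (TTouch (d := 4) (N := 13 * M)) (fun Z : (tsys 4 (13 * M)).Dom => Z.1) (actT 13 M r hr k 1) (CR 13 M).1 -
          locE (TTouch (d := 4) (N := 13 * M)) (fun Z : (tsys 4 (13 * M)).Dom => Z.1) (actT 13 M r hr k 0) (CR 13 M).1‖ ≤
        K₀ 64 8 * Real.exp (-3)) :=
  ⟨⟨towerEnd_live 5 M r hr (by norm_num) hr0 k, towerEnd_fires_closed 5 M r hr (by norm_num) k, decayFactor_lt_one 5 M (by norm_num)⟩,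
    ⟨towerEnd_live 13 M r hr (by norm_num) hr0 k, towerEnd_fires_closed 13 M r hr (by norm_num) k⟩⟩

end Live

end Summit.QuantumFields.BalabanUV.T4Continuum.NE1p.DressedSmallFieldNestedToriTower

end
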